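import Mathlib
import Summits.PneNP.PneNP.Theses.OverlapGapAlgebra
import Summits.PneNP.PneNP.Theorems.OverlapGapAlgebraSolvableImpliesStableSectionLexLocality
import Summits.PneNP.PneNP.Theorems.OverlapGapAlgebraSolvableImpliesStableSectionBfsWitness
import Summits.PneNP.PneNP.Theorems.OverlapGapAlgebraSolvableImpliesStableSectionHallCount
import Summits.PneNP.PneNP.Theorems.OverlapGapAlgebraSolvableImpliesStableSectionPeelCount
import Summits.PneNP.PneNP.Theorems.OverlapGapAlgebraSolvableImpliesStableSectionLowDensityAsymptotics
import Summits.PneNP.PneNP.Theorems.OverlapGapAlgebraSolvableImpliesStableSectionLowDensityAssembly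

/-!
# Exact sections at low density — the crux `SolvableImpliesStableSection` (stmt-PneNP-2463) holds for `α ≤ 1/(32k²)`

Line `Sketch`, lead prover-line-stmt-PneNP-2463-c1-0 (continuation c1), cycle 1.  This file composes the six landed
stubs of the low-density block of skeleton v3 (`stub_lexLocality`, `stub_bfsWitness`, `stub_hallCount`,
`stub_peelCount`, `stub_lowDensityAsymptotics`, `stub_lowDensityAssembly`) into:

* `conclusion_low_density` — for every `k ≥ 3`, `0 < α ≤ 1/(32k²)`, `η > 0`, `ν ≥ 0` and `c > 0`, EVENTUALLY in `n`
  (so in particular infinitely often) some map `g` (the `toLex`-least satisfying assignment) is `ν`-valid at every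
  splice point of the Bresler–Huang resampling path and moves `≤ η n` between consecutive splice points on at least
  an `e^{-cn}` fraction (in fact `≥ 1/2`) of all path tuples — the CONCLUSION of the crux, with no hypothesis;
* `solvableImpliesStableSection_of_density_le` — hence the crux restricted to `α ≤ 1/(32k²)` is a theorem (its
  solvability hypothesis is not used).

Mechanism (f-free, second calibration of the crux after `…ConstSection` (`ν > 2^{-k}`) and `…EtaGeOne` (`η ≥ 1`)):
Hall/SDR expansion of sparse random `k`-CNF (`k ≥ 3`) makes all `k(mk+1)` splice instances satisfiable with failure
probability `O(1/n)`; the lex-least solution is LOCAL across the clause-sharing components of the pooled pair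
`(Ψ_r, Ψ_{r+1})`, and those components have `< 2 log₂ n + 4` clauses w.h.p. by a first moment over BFS witnesses at
`16 k² α ≤ 1/2`.  This answers refuter note (i) on the item (quantifier shape: at FIXED small `k` the conclusion is
owed for arbitrarily small `η` and `ν`) in the affirmative at low density: stable exact sections exist there for
all `η, ν > 0` simultaneously.  Together with the other calibrations the contentful strip of the crux is
`1/(32k²) < α < 2^k`, `η < 1`, `ν ≤ 2^{-k}` (skeleton v3's parked `stub_transferCore`).
-/

set_option linter.dupNamespace false -- `Summit.PneNP.PneNP.…`: summit = sub-problem (D-0017)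

namespace Summit.PneNP.PneNP.Cruxes.SolvableImpliesStableSection.Sketch

open Finset
open scoped Classical

/-- **The crux's conclusion at low density, unconditionally** (every `k ≥ 3`, `0 < α ≤ 1/(32k²)`, `η > 0`,
`ν ≥ 0`, `c > 0`): the landed stubs 2–6 fed into the landed assembly (stub 7). -/
theorem conclusion_low_density (k : ℕ) (hk : 3 ≤ k) (α η ν : ℝ) (hα : 0 < α)
    (hαk : α ≤ 1 / (32 * (k : ℝ) ^ 2)) (hη : 0 < η) (hν : 0 ≤ ν) (c : ℝ) (hc : 0 < c) :
    ∀ᶠ n : ℕ in Filter.atTop, ∀ m : ℕ, m = ⌊α * n⌋₊ →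
      ∃ g : (Fin m → Fin k → Fin n × Bool) → (Fin n → Bool),
        Real.exp (-(c * n)) * Fintype.card (Fin (k + 1) → Fin m → Fin k → Fin n × Bool) ≤
        ((Finset.univ.filter fun Ψ : Fin (k + 1) → Fin m → Fin k → Fin n × Bool =>
          let P : Fin k → ℕ → Fin m → Fin k → Fin n × Bool :=
            fun r q a b => if (a : ℕ) * k + b < q then Ψ r.succ a b else Ψ r.castSucc a b
          (∀ r : Fin k, ∀ q ≤ m * k, ((Finset.univ.filter fun i : Fin m =>
            ∀ j, g (P r q) (P r q i j).1 ≠ (P r q i j).2).card : ℝ) ≤ ν * m) ∧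
          ∀ r : Fin k, ∀ q < m * k,
            (hammingDist (g (P r q)) (g (P r (q + 1))) : ℝ) ≤ η * n).card : ℝ) :=
  stub_lowDensityAssembly k hk α η ν hα hαk hη hν
    (fun k m n Φ Φ' a Scl W h1 h2 h3 h4 x y hx hy =>
      stub_lexLocality k m n Φ Φ' a Scl W h1 h2 h3 h4 x y hx hy)
    stub_bfsWitness
    (fun k m n hk hn hmn r q => stub_hallCount k m n hk hn hmn r q)
    (fun k m n hn r u f hf p hp => stub_peelCount k m n hn r u f hf p hp)
    (fun k hk α η c hα hαk hη hc => stub_lowDensityAsymptotics k hk α η c hα hαk hη hc) c hc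

/-- **The crux restricted to low density is a theorem** (hypothesis unused): for every `k ≥ 3`,
`0 < α ≤ 1/(32k²)`, `η, ν > 0`, ANY hypothesis (in particular efficient solvability with non-vanishing probability)
implies the conclusion of `SolvableImpliesStableSection` at `(k, α, η, ν)` — stated in exactly the crux's shape
(`∃ᶠ n`), from the eventual statement `conclusion_low_density`. -/
theorem solvableImpliesStableSection_of_density_le (k : ℕ) (hk : 3 ≤ k) (α η ν : ℝ) (hα : 0 < α)
    (hαk : α ≤ 1 / (32 * (k : ℝ) ^ 2)) (hη : 0 < η) (hν : 0 < ν) (c : ℝ) (hc : 0 < c) :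
    ∃ᶠ n : ℕ in Filter.atTop, ∀ m : ℕ, m = ⌊α * n⌋₊ →
      ∃ g : (Fin m → Fin k → Fin n × Bool) → (Fin n → Bool),
        Real.exp (-(c * n)) * Fintype.card (Fin (k + 1) → Fin m → Fin k → Fin n × Bool) ≤
        ((Finset.univ.filter fun Ψ : Fin (k + 1) → Fin m → Fin k → Fin n × Bool =>
          let P : Fin k → ℕ → Fin m → Fin k → Fin n × Bool :=
            fun r q a b => if (a : ℕ) * k + b < q then Ψ r.succ a b else Ψ r.castSucc a b
          (∀ r : Fin k, ∀ q ≤ m * k, ((Finset.univ.filter fun i : Fin m =>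
            ∀ j, g (P r q) (P r q i j).1 ≠ (P r q i j).2).card : ℝ) ≤ ν * m) ∧
          ∀ r : Fin k, ∀ q < m * k,
            (hammingDist (g (P r q)) (g (P r (q + 1))) : ℝ) ≤ η * n).card : ℝ) :=
  (conclusion_low_density k hk α η ν hα hαk hη hν.le c hc).frequently

end Summit.PneNP.PneNP.Cruxes.SolvableImpliesStableSection.Sketch
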